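import Mathlib
import HarnessLib
import Summits.HubbardSuperconductivity.HubbardSuperconductivity.Theorems.KLProgrammeH10TwoPointLimitKlAnisoOffUmklappCountWidePrescribed
import Summits.HubbardSuperconductivity.HubbardSuperconductivity.Theorems.KLProgrammeKLRegimeSplitOnWindow

/-!
# Route `KLProgramme` — K3 engine (stmt-HubbardSuperconductivity-20437), stub (b) (ℓ)/(I2), item (R): the keyed off-class relative count with a SET of
# prescribed fine legs (exponent `(m+1) − |E| − 2`, wide free bundle) IN THE STUB-(b) BINDERS and ON `klWindowC`

Cell gate-hubbard-kl, seat p4 g14.  Wrappers of `card_relCount_prescribed_offUmklapp_klAniso_le_frame_widePrescribed` (…KlAnisoOffUmklappCountWidePrescribed):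
`…_le_frameOK_widePrescribed` (`C` and the geometric constants before `R`, `FrameOK R U (nScales β) ν K` frames) and `…_le_window_widePrescribed` (`μ ∈ klWindowC`)
— the `(R)`-row for k3c2-p3's split bricks (`hRoff` on the graded redundant sub-class: two free coarse legs more than `Θ + 5w_k` apart).
Everything is PROVED; no definitions, no named facts.  References: BGM 2006 App. A3 [cite: BenfattoGiulianiMastropietro2006]; BGM 2003 §3.1, §7.4
[cite: BenfattoGiulianiMastropietro2003].
-/

noncomputable section

namespace Summit.HubbardSuperconductivity.HubbardSuperconductivity.Theorems.PerturbedFermiCurve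

set_option linter.dupNamespace false -- summit = problem name (single-conjunct summit), D-0017

open Classical
open Real Set Finset
open Literature.MathematicalPhysics.QuantumLattice Literature.MathematicalPhysics.QuantumLattice.BandSectorCounting
open Literature.MathematicalPhysics.QuantumLattice.FermiRG Literature.MathematicalPhysics.QuantumLattice.FermiRG.BGM2003
open Literature.Probability.LatticeModels
open Summit.HubbardSuperconductivity.HubbardSuperconductivity.Theorems.DispersionFlow
open Summit.HubbardSuperconductivity.HubbardSuperconductivity.Theorems.KLRegimeSplit
open Summit.HubbardSuperconductivity.HubbardSuperconductivity.Theorems.KLProgrammeLegKernels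
open Summit.HubbardSuperconductivity.HubbardSuperconductivity.Theorems.TorusFourierL2

/-- **The keyed off-class relative count with a prescribed SET of fine legs, ON EVERY ADMISSIBLE FRAME IN THE KL REGIME** (constants before `R`).
[cite: BenfattoGiulianiMastropietro2006, App. A3 Lemma A3.1; BenfattoGiulianiMastropietro2003, §3.1 Lemma 3.1 (4.3), §7.4] -/
theorem card_relCount_prescribed_offUmklapp_klAniso_le_frameOK_widePrescribed :
    ∀ μ₁ μ₂ : ℝ, -4 < μ₁ - 4 * klE0 → μ₁ ≤ μ₂ → μ₂ + 4 * klE0 < 0 →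
      ∃ C : ℝ, 0 < C ∧
      ∃ c₂ cb K₁ K₂ c₀ c₂' : ℝ, 0 ≤ c₂ ∧ 0 < cb ∧ 2 + c₂ ≤ K₁ ∧ 0 < K₂ ∧ 0 < c₀ ∧ 0 < c₂' ∧ ∀ R : RenConsts, (∀ j, 0 ≤ R.Gfr j) →
      ∃ c₃ : ℝ, 0 < c₃ ∧ ∃ U₀ : ℝ, 0 < U₀ ∧
      ∀ c : ℝ, 0 < c → c ≤ c₃ → ∀ U : ℝ, 0 < U → U ≤ U₀ → ∀ β : ℝ, klBetaMin ≤ β → β ≤ Real.exp (c / U ^ 2) →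
      ∀ μ ∈ Set.Icc μ₁ μ₂, ∀ (ν : ℝ) (K : TrigPolyC4v), FrameOK R U (nScales β) ν K →
      ∀ (L M : ℕ) [NeZero L] (m k J' : ℕ), k ≤ J' →
      ∀ (A'' : Finset (Fin (m + 1) → SectorLeg (sectorCount J'))),
        A'' ⊆ bgmSectorSet L M (klAnisoFamily L M β μ K klE0 J') (m + 1) →
      ∀ (E : Finset (Fin (m + 1))), E.card + 3 ≤ m + 1 → ∀ (τ'' : Fin (m + 1) → SectorLeg (sectorCount J')),
      ∀ σ' : Fin (m + 1) → SectorLeg (sectorCount k),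
      (∀ G : Fin 2 → ℤ, G ≠ 0 → ∃ j : Fin 2, ((m : ℝ) + 1) * C * sectorWidth k <
          |∑ i, (if (σ' i).2 = 0 then klFermiPoint μ K (sectorCenter k (σ' i).1.1) j
              else -klFermiPoint μ K (sectorCenter k (σ' i).1.1) j) - 2 * π * (G j : ℝ)|) →
      ∀ Ψ₀ : ℝ, 0 ≤ Ψ₀ →
      (∀ e ∈ E, ∀ i : Fin (m + 1), i ∉ E → pairAngle
          (sectorCenter k (if (σ' e).2 = 0 then ((σ' e).1.1 : ℕ) else
            if ((σ' e).1.1 : ℕ) < 2 ^ k then ((σ' e).1.1 : ℕ) + 2 ^ k else ((σ' e).1.1 : ℕ) - 2 ^ k))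
          (sectorCenter k (if (σ' i).2 = 0 then ((σ' i).1.1 : ℕ) else
            if ((σ' i).1.1 : ℕ) < 2 ^ k then ((σ' i).1.1 : ℕ) + 2 ^ k else ((σ' i).1.1 : ℕ) - 2 ^ k)) ≤ Ψ₀) →
      ∀ (Θ LΨ Bfib : ℝ), LΨ = (m + 1 : ℕ) + c₂ * (E.card * (Ψ₀ + 5 * sectorWidth k)) / (K₁ * Θ) → (2 : ℝ) ^ (-(J' : ℤ)) ≤ Θ →
        cb * (2 : ℝ) ^ (-(J' : ℤ)) ≤ Θ → K₂ * LΨ * (cb * (2 : ℝ) ^ (-(J' : ℤ))) ≤ c₂' * Θ →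
        max ((2 * ((2 * c₀ * K₂ * cb / π + 1) * LΨ)) ^ 2) (4 * cb ^ 2 * K₂ ^ 2 / 1 ^ 2 * LΨ ^ 2) ≤ Bfib →
      ∀ (i₀ j₀ : Fin (m + 1)), i₀ ∉ E → j₀ ∉ E →
      Θ + 5 * sectorWidth k < pairAngle
          (sectorCenter k (if (σ' i₀).2 = 0 then ((σ' i₀).1.1 : ℕ) else
            if ((σ' i₀).1.1 : ℕ) < 2 ^ k then ((σ' i₀).1.1 : ℕ) + 2 ^ k else ((σ' i₀).1.1 : ℕ) - 2 ^ k))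
          (sectorCenter k (if (σ' j₀).2 = 0 then ((σ' j₀).1.1 : ℕ) else
            if ((σ' j₀).1.1 : ℕ) < 2 ^ k then ((σ' j₀).1.1 : ℕ) + 2 ^ k else ((σ' j₀).1.1 : ℕ) - 2 ^ k)) →
      ((((A''.filter fun σ'' => (∀ e ∈ E, σ'' e = τ'' e) ∧ ∀ i,
          (∃ q : FreqMomentum L M, klAnisoFamily L M β μ K klE0 J' (σ'' i).1.1 q ≠ 0 ∧
            bgmFatMultiplier L M klE0 β (nambuXiCT L μ K) k (σ' i).1.1 q ≠ 0) ∧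
          (σ' i).1.2 = (σ'' i).1.2 ∧ (σ' i).2 = (σ'' i).2).card : ℕ) : ℝ)) ≤
        (5 : ℝ) ^ (m + 1) * ((m + 1 : ℕ) ^ 2 * (Bfib * (3 * (2 : ℝ) ^ (J' - k)) ^ ((m + 1) - E.card - 2))) := by
  intro μ₁ μ₂ hμ₁ h12 hμ₂
  obtain ⟨κ, hκ, C, hC, c₂, cb, K₁, K₂, c₀, c₂', h1, h2, h3, h4, h5, h6, h⟩ :=
    card_relCount_prescribed_offUmklapp_klAniso_le_frame_widePrescribed μ₁ μ₂ hμ₁ h12 hμ₂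
  refine ⟨C, hC, c₂, cb, K₁, K₂, c₀, c₂', h1, h2, h3, h4, h5, h6, fun R hR => ?_⟩
  obtain ⟨c₃, hc₃, U₀, hU₀, hthr⟩ := frame_thresholds hR hκ
  refine ⟨c₃, hc₃, U₀, hU₀, ?_⟩
  intro c hc hcle U hU hUle β hβmin hβc μ hμ ν K hK L M _ m k J'
  exact h K _ (fun q j hj => norm_iteratedFDeriv_frameShift_le_of_frameOK_regime hR hc.le hβmin hβc hK q hj)
    (hthr c U hc.le hcle hU hUle) μ hμ L M β m k J'

/-- **The keyed off-class relative count with a prescribed SET of fine legs, on `klWindowC`** — the `(R)` row for the graded redundant sub-class of the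
`hRoff` slot of k3c2-p3's split bricks (two free coarse legs more than `Θ + 5w_k` apart; exponent `(m+1) − |E| − 2`).
[cite: BenfattoGiulianiMastropietro2006, App. A3 Lemma A3.1; BenfattoGiulianiMastropietro2003, §3.1 Lemma 3.1 (4.3), §7.4] -/
theorem card_relCount_prescribed_offUmklapp_klAniso_le_window_widePrescribed :
    ∃ C : ℝ, 0 < C ∧
      ∃ c₂ cb K₁ K₂ c₀ c₂' : ℝ, 0 ≤ c₂ ∧ 0 < cb ∧ 2 + c₂ ≤ K₁ ∧ 0 < K₂ ∧ 0 < c₀ ∧ 0 < c₂' ∧ ∀ R : RenConsts, (∀ j, 0 ≤ R.Gfr j) →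
      ∃ c₃ : ℝ, 0 < c₃ ∧ ∃ U₀ : ℝ, 0 < U₀ ∧
      ∀ c : ℝ, 0 < c → c ≤ c₃ → ∀ U : ℝ, 0 < U → U ≤ U₀ → ∀ β : ℝ, klBetaMin ≤ β → β ≤ Real.exp (c / U ^ 2) →
      ∀ μ ∈ klWindowC, ∀ (ν : ℝ) (K : TrigPolyC4v), FrameOK R U (nScales β) ν K →
      ∀ (L M : ℕ) [NeZero L] (m k J' : ℕ), k ≤ J' →
      ∀ (A'' : Finset (Fin (m + 1) → SectorLeg (sectorCount J'))),
        A'' ⊆ bgmSectorSet L M (klAnisoFamily L M β μ K klE0 J') (m + 1) →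
      ∀ (E : Finset (Fin (m + 1))), E.card + 3 ≤ m + 1 → ∀ (τ'' : Fin (m + 1) → SectorLeg (sectorCount J')),
      ∀ σ' : Fin (m + 1) → SectorLeg (sectorCount k),
      (∀ G : Fin 2 → ℤ, G ≠ 0 → ∃ j : Fin 2, ((m : ℝ) + 1) * C * sectorWidth k <
          |∑ i, (if (σ' i).2 = 0 then klFermiPoint μ K (sectorCenter k (σ' i).1.1) j
              else -klFermiPoint μ K (sectorCenter k (σ' i).1.1) j) - 2 * π * (G j : ℝ)|) →
      ∀ Ψ₀ : ℝ, 0 ≤ Ψ₀ →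
      (∀ e ∈ E, ∀ i : Fin (m + 1), i ∉ E → pairAngle
          (sectorCenter k (if (σ' e).2 = 0 then ((σ' e).1.1 : ℕ) else
            if ((σ' e).1.1 : ℕ) < 2 ^ k then ((σ' e).1.1 : ℕ) + 2 ^ k else ((σ' e).1.1 : ℕ) - 2 ^ k))
          (sectorCenter k (if (σ' i).2 = 0 then ((σ' i).1.1 : ℕ) else
            if ((σ' i).1.1 : ℕ) < 2 ^ k then ((σ' i).1.1 : ℕ) + 2 ^ k else ((σ' i).1.1 : ℕ) - 2 ^ k)) ≤ Ψ₀) →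
      ∀ (Θ LΨ Bfib : ℝ), LΨ = (m + 1 : ℕ) + c₂ * (E.card * (Ψ₀ + 5 * sectorWidth k)) / (K₁ * Θ) → (2 : ℝ) ^ (-(J' : ℤ)) ≤ Θ →
        cb * (2 : ℝ) ^ (-(J' : ℤ)) ≤ Θ → K₂ * LΨ * (cb * (2 : ℝ) ^ (-(J' : ℤ))) ≤ c₂' * Θ →
        max ((2 * ((2 * c₀ * K₂ * cb / π + 1) * LΨ)) ^ 2) (4 * cb ^ 2 * K₂ ^ 2 / 1 ^ 2 * LΨ ^ 2) ≤ Bfib →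
      ∀ (i₀ j₀ : Fin (m + 1)), i₀ ∉ E → j₀ ∉ E →
      Θ + 5 * sectorWidth k < pairAngle
          (sectorCenter k (if (σ' i₀).2 = 0 then ((σ' i₀).1.1 : ℕ) else
            if ((σ' i₀).1.1 : ℕ) < 2 ^ k then ((σ' i₀).1.1 : ℕ) + 2 ^ k else ((σ' i₀).1.1 : ℕ) - 2 ^ k))
          (sectorCenter k (if (σ' j₀).2 = 0 then ((σ' j₀).1.1 : ℕ) else
            if ((σ' j₀).1.1 : ℕ) < 2 ^ k then ((σ' j₀).1.1 : ℕ) + 2 ^ k else ((σ' j₀).1.1 : ℕ) - 2 ^ k)) →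
      ((((A''.filter fun σ'' => (∀ e ∈ E, σ'' e = τ'' e) ∧ ∀ i,
          (∃ q : FreqMomentum L M, klAnisoFamily L M β μ K klE0 J' (σ'' i).1.1 q ≠ 0 ∧
            bgmFatMultiplier L M klE0 β (nambuXiCT L μ K) k (σ' i).1.1 q ≠ 0) ∧
          (σ' i).1.2 = (σ'' i).1.2 ∧ (σ' i).2 = (σ'' i).2).card : ℕ) : ℝ)) ≤
        (5 : ℝ) ^ (m + 1) * ((m + 1 : ℕ) ^ 2 * (Bfib * (3 * (2 : ℝ) ^ (J' - k)) ^ ((m + 1) - E.card - 2))) :=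
  card_relCount_prescribed_offUmklapp_klAniso_le_frameOK_widePrescribed (-1.05) (-0.15) (by norm_num [klE0]) (by norm_num) (by norm_num [klE0])

end Summit.HubbardSuperconductivity.HubbardSuperconductivity.Theorems.PerturbedFermiCurve

end
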